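import Literature.NumberTheory.EllipticCurves.PAdicBSD
import HarnessLib

/-!
# Wuthrich 2014: Kato's divisibility integrally at a reducible prime, and `#Ш ∣ C · #Ш_an`

Source (read: Documenta Math. 19 (2014) 381–402 — the author's version and the CC-BY text
`doi:10.4171/dm/450` by the first transcriber; the publisher PDF, EMS Press, by the cell's
literature seat on 2026-08-19, whence the JOURNAL pagination now used: Thm. 16 p. 397, Cor. 18
p. 398, Prop. 21 p. 400): C. Wuthrich, *On the integrality of modular symbols and Kato's
Euler system for elliptic curves*, Doc. Math. 19 (2014) 381–402 [Wuthrich2014]. Two NAMED FACTS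
(`def … : Prop`, nothing asserted, D-0014), transcribed with their printed hypotheses:

* `charIdeal_dvd_padicLFunction` — **Theorem 16** (p. 397), good ordinary case: for `p > 2` with
  `E[p]` reducible, `char_Λ X(E)` divides `(L_p(E))` in `Λ = ℤ_p⟦T⟧` — the reducible companion of
  the surjective-image clause (3) of the tree's `kato_divisibility` (Kato, Astérisque 295, Thm.
  17.4), in the same vocabulary (`SelmerDualData`, `charIdeal`, `iwasawaToPowerSeries`,
  `padicLFunction`, file `PAdicBSD`);
* `sha_dvd_analyticSha` — **Proposition 21** (p. 400): if `L(E,1) ≠ 0` then `#Ш(E/ℚ)` divides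
  `C · (L(E,1)/Ω⁺_E) · #E(ℚ)² / ∏_v c_v` with `C ∈ ℚ` divisible only by `2`, by primes of additive
  reduction and by primes at which `ρ̄_{E,p}` is neither surjective nor contained in a Borel.

Period normalisations (the only translation made). Wuthrich (p. 381) writes
`λ(r) = 2πi ∫_∞^r f = [r]⁺_E Ω⁺_E + [r]⁻_E Ω⁻_E i` with `Ω⁺_E` the least positive real element of the
NÉRON lattice of `E` itself, and `L_p(E)` is the Mazur–Swinnerton-Dyer `p`-adic `L`-function built
from the `[r]⁺_E` (§5); in Prop. 21, `∏_v c_v` includes `c_∞ =` the number of components of `E(ℝ)`.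
The tree's `W.realPeriodRat = Ω_E = ∫_{E(ℝ)}|ω| = c_∞ · Ω⁺_E` (design notes of `BSDInvariants`,
`ModularSymbols.plusPeriod`), so `(L(E,1)/Ω⁺_E)/∏_v c_v = (L(E,1)/Ω_E)/∏_ℓ c_ℓ`, and the tree's
`padicLFunction f α` is built from `[r]⁺_f = re{∞,r}_f/Ω⁺_f` (`ratPlusSymbol`, normalised by the
period `Ω⁺_f = plusPeriod f` of the NEWFORM lattice), so `L_p(E) = ± c_∞ · ϖ · padicLFunction f α`
for the rational `ϖ` with `ϖ · Ω_E = Ω⁺_f` (the `ϖ` of the `p`-adic BSD statement bsd.S24 of `PAdicBSD`); at an odd prime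
`c_∞ ∈ {1, 2}` and the sign are units of `ℤ_p`, invisible in the ideal statement of Thm. 16, and a
power of `2` is absorbed by Prop. 21's constant `C`.

What is NOT here: the split multiplicative case of Thm. 16 (`I · char_Λ X(E) ∣ (L_p(E))`, which
needs the exceptional-case `L`-function `IsSplitMultPAdicLFunctionOf`), Thm. 4 (the curve `E_•`
with `p`-integral modular symbols), Thm. 13, Cor. 18–19, Lemma 20; no proof is attempted (Kato's
Euler system is not in Mathlib).
General form: Thm. 16 is printed for semi-stable (good ordinary OR multiplicative) reduction at
`p`; this file transcribes the GOOD ORDINARY clause, and the MULTIPLICATIVE clauses (nonsplit: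
`char ∣ (L_p)`; split: `I · char ∣ (L_p)`; `Λ`-torsion in both) are the sibling named fact
`Wuthrich2014.thm16_charIdeal_dvd_multiplicative_of_reducible`
(`Wuthrich2014/ReducibleMultiplicativeDivisibility.lean`); since a reducible `E[p]` at a good
`p > 2` forces ordinary reduction (p. 397), the two decls together state Thm. 16 exactly
(cross-reference of record per ARM P D-AUDIT-r06-Q05, sheet 1c89d2a117df06db, 2026-08-26; the
former `TODO(general form)` here was a stale pointer, not a missing statement).
-/

set_option autoImplicit false

noncomputable section

open scoped Classical MatrixGroups ModularForm

open CongruenceSubgroup WeierstrassCurve Literature.NumberTheory.EllipticCurves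
  Literature.NumberTheory.EllipticCurves.ModularForms

namespace Literature.NumberTheory.EllipticCurves.Wuthrich2014

/-- **Wuthrich 2014, Theorem 16 (good ordinary case): Kato's divisibility `char_Λ X(E) ∣ (L_p(E))`
holds integrally, in `Λ`, at an odd prime where `E[p]` is reducible.** As printed
(Doc. Math. 19 (2014), Thm. 16, p. 397): "Let `E/ℚ` be an elliptic curve and let `p > 2` be a
prime. Suppose that `E` has semi-stable reduction at `p` and that `E[p]` is reducible as a
`G_ℚ`-module. Then `char_Λ X(E)` divides the ideal generated by `L_p(E)`. If the reduction of `E`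
is split multiplicative at `p`, then `I · char_Λ X(E)` divides the ideal generated by `L_p(E)`, where
`I` is the kernel of the homomorphism `Λ → ℤ_p` that sends all elements of [`Γ` to `1`]." Here
(§5, p. 397) `X(E)` is the Pontryagin dual of the Selmer group of `E` over the cyclotomic
`ℤ_p`-extension, "a finitely generated `Λ`-module. If the reduction is good ordinary, Theorem 17.4
in [Kato] shows that `X(E)` is `Λ`-torsion", and `L_p(E) ∈ Λ` (Cor. 18, p. 398, printed for
"semi-stable ordinary reduction at `p > 2`") is the analytic `p`-adic `L`-function of `E`
normalised by the Néron lattice of `E` (p. 381); Lemma 17 (p. 397): "To prove Theorem 16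
for `E`, it is sufficient to prove it for any one curve in the isogeny class of `E`" (Perrin-Riou's
formula for the change of `μ` under isogeny). This is Kato's divisibility (Astérisque 295, Thm.
17.4; tree `kato_divisibility`, clause 3 printed for surjective `ρ_{E,p}`) made integral in the
reducible case, where the Euler-system argument alone loses a power of `p` (loc. cit., §1).
Transcription (good ordinary case only; vocabulary of `PAdicBSD`/`kato_divisibility`): `W` a globally
minimal model of `E`, `p ≠ 2` good ordinary (`IsOrdinaryAt W p`; for `p > 2` of good reduction with
`E[p]` reducible the reduction is automatically ordinary, loc. cit. §5), `E[p]` reducible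
(`¬ W.HasIrreducibleModPGaloisRep p`, i.e. `ρ̄_{E,p}` lands in a Borel), `ℚ_∞/ℚ` the cyclotomic
`ℤ_p`-extension `κ` with topological generator `γ` matching the cyclotomic variable, `f` the newform
of `E`, `D` a Pontryagin-dual datum (`X = D.X`, `char_Λ X = D.charIdeal`), and `ϖ ∈ ℚ` with
`ϖ · Ω_E = Ω⁺_f` (so that `ϖ · padicLFunction f α`, `α = unitRoot W p`, is `L_p(E)` up to the unit
`± c_∞ ∈ ℤ_pˣ`, see the module docstring). Conclusion: `X` is `Λ`-torsion and
`ϖ · L_p ∈ ι(char_Λ X)`, i.e. `ϖ · padicLFunction f α = ι g` for some `g ∈ char_Λ X`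
(`ι = iwasawaToPowerSeries p : Λ ↪ ℚ_p⟦T⟧`) — "`char_Λ X(E)` divides `(L_p(E))` in `Λ`".
[cite: Wuthrich2014, Thm. 16 (p. 397), Lemma 17 (p. 397), Cor. 18 (p. 398)] -/
def charIdeal_dvd_padicLFunction : Prop :=
  ∀ (W : WeierstrassCurve ℚ) [W.IsElliptic] [W.IsGloballyMinimal] (p : ℕ) [Fact p.Prime]
    {κ : ZpExtension ℚ p} {γ : Field.absoluteGaloisGroup ℚ} {N : ℕ} [NeZero N]
    {f : CuspForm (Gamma0 N) 2},
    p ≠ 2 → IsOrdinaryAt W p → ¬ W.HasIrreducibleModPGaloisRep p →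
    κ.IsCyclotomic → κ.IsTopGenerator γ → IsCyclotomicVariable p γ → IsNewformOf W f →
    ∀ (D : W.SelmerDualData κ γ) (ϖ : ℚ), (ϖ : ℝ) * W.realPeriodRat = plusPeriod f →
      D.IsTorsion ∧
      ∃ g ∈ D.charIdeal, iwasawaToPowerSeries p g =
        PowerSeries.C ((ϖ : ℚ) : ℚ_[p]) * padicLFunction f (unitRoot W p : ℚ_[p])

/-- **Wuthrich 2014, Proposition 21: `#Ш(E/ℚ)` divides `C · #Ш(E/ℚ)_an`, with `C` supported at
`2`, additive primes and primes of exotic image.** As printed (Doc. Math. 19 (2014), Prop. 21,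
p. 400, "the usual application" of Thm. 16 with Kato's theorem to the Birch–Swinnerton-Dyer
formula): "Let `E` be an elliptic curve over `ℚ` such that `L(E, 1) ≠ 0`. Let `c_v` be the
Tamagawa number of `E` at each finite place `v` and the number of components in `E(ℝ)` for `v = ∞`.
Then `#Ш(E/ℚ)` divides `C · (L(E,1)/Ω⁺_E) · (#E(ℚ))² / ∏_v c_v` where `C` is a rational number only
divisible by `2`, primes of additive reduction or primes for which the Galois representation on
`E[p]` is neither surjective nor contained in a Borel subgroup. In particular, for semi-stable curve
`C` is a power of `2`." (`Ω⁺_E` = the least positive real Néron period, p. 381.)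
Transcription, for a globally minimal model `W` of `E` (so that `W.realPeriodRat = Ω_E = c_∞ Ω⁺_E`
and `W.tamagawaProduct = ∏_{ℓ finite} c_ℓ`; hence `(L(E,1)/Ω⁺_E) · #E(ℚ)²/∏_v c_v =
(L(E,1)/Ω_E) · #E(ℚ)²/∏_ℓ c_ℓ`, the module docstring): `L(E,1)/Ω_E` is a rational number `q`
(Manin–Drinfeld; part of the printed statement's meaning), and there are `C ∈ ℚ`, `C ≠ 0`, whose
`p`-adic valuation vanishes at every prime `p` except possibly `p = 2`, primes of additive reduction
(`HasAdditiveReduction` of the `ℤ_p`-minimal model, Mathlib) and primes at which `ρ̄_{E,p}` is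
neither surjective (`HasSurjectiveModNGaloisRep`) nor reducible (contained in a Borel ⇔
`¬ HasIrreducibleModPGaloisRep`), and an INTEGER `m` with
`C · q · #E(ℚ)² / ∏_ℓ c_ℓ = m · #Ш(E/ℚ)` ("divides"). The finiteness of `E(ℚ)` and of `Ш(E/ℚ)` —
theorems when `L(E,1) ≠ 0` (Kolyvagin; Kato, tree fact `kato_finite_of_L_one_ne_zero`; bsd.S17) and
implicit in the printed statement — are taken as explicit hypotheses so that `Nat.card E(ℚ)` and
`W.shaOrder` are genuine orders (this only weakens the fact). Consequence used by the residual-class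
files: at an odd prime `p` of good or multiplicative reduction with `ρ̄_{E,p}` surjective or
reducible, `ord_p #Ш(E/ℚ) ≤ ord_p #Ш(E/ℚ)_an`.
[cite: Wuthrich2014, Prop. 21 (p. 400)] -/
def sha_dvd_analyticSha : Prop :=
  ∀ (W : WeierstrassCurve ℚ) [W.IsElliptic] [W.IsGloballyMinimal],
    W.entireLFunction 1 ≠ 0 → Finite W.toAffine.Point → Finite W.sha →
    ∃ (q C : ℚ) (m : ℤ),
      W.entireLFunction 1 / (W.realPeriodRat : ℂ) = (q : ℂ) ∧ C ≠ 0 ∧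
      (∀ (p : ℕ) [Fact p.Prime], padicValRat p C ≠ 0 →
        p = 2 ∨ ((W.baseChange ℚ_[p]).minimal ℤ_[p]).HasAdditiveReduction ℤ_[p] ∨
          (¬ W.HasSurjectiveModNGaloisRep p ∧ W.HasIrreducibleModPGaloisRep p)) ∧
      C * q * (Nat.card W.toAffine.Point : ℚ) ^ 2 / (W.tamagawaProduct : ℚ) =
        (m : ℚ) * (W.shaOrder : ℚ)

end Literature.NumberTheory.EllipticCurves.Wuthrich2014

end
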